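import Summits.BirchSwinnertonDyer.BirchSwinnertonDyer.Theorems.Rank2ObservatoryReductionWitnessT
import HarnessLib

/-!
# BirchSwinnertonDyer — rank ≥ 2 observatory: shift witnesses `R + T ∉ 2E(ℚ)` one prime at a time

HONEST FRAMING: per-curve certified theorems and census instruments; no claim on BSD in rank ≥ 2.

Tools for kernel rank certificates on curves with several rational `2`-power torsion points, where
the coset condition `R ∉ 2E(ℚ) + E(ℚ)[2^u]` splits into finitely many conditions `R + h ∉ 2E(ℚ)`
(`h` in the rational `2`-power torsion) and NO single good prime need witness all of them (the
halving fields of the `R + h` can cover every Frobenius class): each condition is certified at its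
own good prime `q` — `R̃ ∉ 2Ẽ(𝔽_q)` (`xDoubleFree`), `(R + T)~ ∉ 2Ẽ(𝔽_q)` with the sum by a chord
certificate mod `q` (`shiftFree`), and for `R = P₁ + P₂` two chords (`sumFree`, `sumShiftFree`) —
and pulled back along the reduction homomorphism `reduceMod`. Also: the abstract coset lemma for
`A[2] ⊆ {0, T₁, T₂, T₃}`, a generic `2`-power descent, `eq_of_reduceMod_eq_twoTorsion` (a rational
`2`-torsion point is determined by its reduction at a good odd prime) and
`two_nsmul_ne_some_of_xDoubleFree`. Sorry-free.
References: Silverman AEC (2009) III.2.3, VII.3.1(b); Cremona (1997) §3.3, §3.5.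
-/

-- single-conjunct summit: `Summit.BirchSwinnertonDyer.BirchSwinnertonDyer.…` repeats the name by design
set_option linter.dupNamespace false

namespace Summit.BirchSwinnertonDyer.BirchSwinnertonDyer.Rank2Observatory

open WeierstrassCurve Literature.NumberTheory.EllipticCurves

section Abstract

variable {A : Type*} [AddCommGroup A]

/-- If `A[2] ⊆ {0, T₁, T₂, T₃}` and none of `x, x + T₁, x + T₂, x + T₃` lies in `2A`, then
`x ∉ 2A + A[2]`. [folklore] -/
theorem not_mem_twoCoset_one_of_twoTorsion_subset3 {T₁ T₂ T₃ x : A}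
    (h2 : ∀ τ : A, (2 : ℤ) • τ = 0 → τ = 0 ∨ τ = T₁ ∨ τ = T₂ ∨ τ = T₃)
    (hx : x ∉ twoCoset A 0) (hx₁ : x + T₁ ∉ twoCoset A 0) (hx₂ : x + T₂ ∉ twoCoset A 0)
    (hx₃ : x + T₃ ∉ twoCoset A 0) : x ∉ twoCoset A 1 := by
  rintro ⟨b, c, hc, rfl⟩
  rw [pow_one] at hc
  rcases h2 c hc with rfl | rfl | rfl | rfl
  · exact hx ⟨b, 0, by rw [smul_zero], rfl⟩
  · exact hx₁ ⟨b + c, 0, by rw [smul_zero], by rw [add_zero, smul_add]; abel⟩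
  · exact hx₂ ⟨b + c, 0, by rw [smul_zero], by rw [add_zero, smul_add]; abel⟩
  · exact hx₃ ⟨b + c, 0, by rw [smul_zero], by rw [add_zero, smul_add]; abel⟩

/-- Generic descent: if `4 • w = 0 → 2 • w = 0` for all `w`, then `2^(k+1) • z = 0 → 2 • z = 0`.
[folklore] -/
theorem two_nsmul_eq_zero_of_pow_nsmul_eq_zero (h42 : ∀ w : A, 4 • w = 0 → 2 • w = 0) :
    ∀ k : ℕ, ∀ z : A, 2 ^ (k + 1) • z = 0 → 2 • z = 0 := by
  intro k
  induction k with
  | zero => intro z hz; simpa using hz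
  | succ k ih =>
    intro z hz
    apply ih
    have hz4 : 4 • (2 ^ k • z) = 0 := by
      rw [← mul_nsmul', show 4 * 2 ^ k = 2 ^ (k + 1 + 1) by ring]; exact hz
    have h2 := h42 (2 ^ k • z) hz4
    rwa [← mul_nsmul', show 2 * 2 ^ k = 2 ^ (k + 1) by ring] at h2

end Abstract

/-! ### Rational `2`-torsion points and doubles under reduction -/

section Rational

variable (V : WeierstrassCurve ℤ)

open scoped Classical in
/-- A rational `2`-torsion point whose reduction at a good odd prime `ℓ` is the reduction of the
integral `2`-torsion point `T = (x_T, y_T)` IS `T` (injectivity of reduction on prime-to-`ℓ`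
torsion). [cite: SilvermanAEC2009, Prop. VII.3.1(b)] -/
theorem eq_of_reduceMod_eq_twoTorsion (ℓ : ℕ) [Fact ℓ.Prime] (hℓ : ¬ (ℓ : ℤ) ∣ V.Δ) (hodd : ℓ ≠ 2)
    {xT yT : ℤ}
    (hT : yT ^ 2 + V.a₁ * xT * yT + V.a₃ * yT = xT ^ 3 + V.a₂ * xT ^ 2 + V.a₄ * xT + V.a₆)
    (hT2 : 2 * yT + V.a₁ * xT + V.a₃ = 0)
    (τ : (V.map (Int.castRingHom ℚ)).toAffine.Point) (hτ : 2 • τ = 0)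
    {hns : (V.map (Int.castRingHom (ZMod ℓ))).toAffine.Nonsingular (xT : ZMod ℓ) (yT : ZMod ℓ)}
    (hred : reduceMod V ℓ hℓ τ = .some (xT : ZMod ℓ) (yT : ZMod ℓ) hns) :
    τ = Affine.Point.some (xT : ℚ) (yT : ℚ)
      (nonsingular_rat_of_eq V (Δ_ne_zero_of_not_dvd V hℓ) hT) := by
  have hΔ : V.Δ ≠ 0 := Δ_ne_zero_of_not_dvd V hℓ
  haveI := isElliptic_rat V hΔ
  have hn : ¬ ℓ ∣ 2 := fun hd =>
    hodd ((Nat.prime_dvd_prime_iff_eq (Fact.out : ℓ.Prime) Nat.prime_two).mp hd)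
  have eT : V.toAffine.Equation xT yT := (Affine.equation_iff xT yT).mpr hT
  set T : (V.map (Int.castRingHom ℚ)).toAffine.Point :=
    .some (xT : ℚ) (yT : ℚ) (nonsingular_rat_of_eq V hΔ hT) with hTdef
  have hTred : reduceMod V ℓ hℓ T = Affine.Point.some (xT : ZMod ℓ) (yT : ZMod ℓ) hns := by
    rw [hTdef, reduceMod_some V ℓ hℓ eT]
  have h2T : 2 • T = 0 := two_nsmul_some_eq_zero V hΔ hT hT2
  have hdiff0 : reduceMod V ℓ hℓ (τ - T) = 0 := by rw [map_sub, hred, hTred, sub_self]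
  have hdiff2 : 2 • (τ - T) = 0 := by rw [nsmul_sub, hτ, h2T, sub_zero]
  exact sub_eq_zero.mp (eq_zero_of_reduceMod_eq_zero V ℓ hℓ (τ - T) hn hdiff2 hdiff0)

open scoped Classical in
/-- An integral point whose reduction at a good prime `q` is no double (`xDoubleFree`) is not twice
a rational point. [cite: SilvermanAEC2009, Prop. VII.3.1(b)] -/
theorem two_nsmul_ne_some_of_xDoubleFree (hΔ : V.Δ ≠ 0) {xT yT : ℤ}
    (hT : yT ^ 2 + V.a₁ * xT * yT + V.a₃ * yT = xT ^ 3 + V.a₂ * xT ^ 2 + V.a₄ * xT + V.a₆)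
    (q : ℕ) [Fact q.Prime] (hq : ¬ (q : ℤ) ∣ V.Δ) (h2 : xDoubleFree V q (xT : ZMod q) = true)
    (w : (V.map (Int.castRingHom ℚ)).toAffine.Point) :
    2 • w ≠ Affine.Point.some (xT : ℚ) (yT : ℚ) (nonsingular_rat_of_eq V hΔ hT) := by
  haveI := isElliptic_rat V hΔ
  intro hwT
  have eT : V.toAffine.Equation xT yT := (Affine.equation_iff xT yT).mpr hT
  have hmem : (Affine.Point.some (xT : ZMod q) (yT : ZMod q)
      (nonsingular_zmod_of_equation V q hq eT) : (V.map (Int.castRingHom (ZMod q))).toAffine.Point)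
        ∈ twoCoset (V.map (Int.castRingHom (ZMod q))).toAffine.Point 0 := by
    refine ⟨reduceMod V q hq w, 0, by simp, ?_⟩
    rw [two_zsmul, add_zero, ← two_nsmul, ← map_nsmul, hwT, reduceMod_some V q hq eT]
  exact not_mem_twoCoset_of_xDoubleFree V q h2 _ hmem

end Rational

/-! ### Shift witnesses: `R + T ∉ 2E(ℚ)` at one good prime per shift -/

section Shift

variable (V : WeierstrassCurve ℤ)

/-- Boolean: `(A, B) ≡ (X, Y) + (x_T, y_T)` mod `q` by a chord certificate and `A` is the abscissa
of no double in `Ẽ(𝔽_q)`. [cite: CremonaAlgorithms1997, §3.5] -/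
def shiftFree (V : WeierstrassCurve ℤ) (q : ℕ) [NeZero q] (X Y xT yT A B : ℤ) : Bool :=
  zmodChord V q (X : ZMod q) (Y : ZMod q) (xT : ZMod q) (yT : ZMod q) (A : ZMod q) (B : ZMod q) &&
    xDoubleFree V q (A : ZMod q)

/-- Boolean: `(X₃, Y₃) ≡ (X₁, Y₁) + (X₂, Y₂)` mod `q` by a chord certificate and `X₃` is the
abscissa of no double in `Ẽ(𝔽_q)`. [cite: CremonaAlgorithms1997, §3.5] -/
def sumFree (V : WeierstrassCurve ℤ) (q : ℕ) [NeZero q] (X₁ Y₁ X₂ Y₂ X₃ Y₃ : ℤ) : Bool :=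
  zmodChord V q (X₁ : ZMod q) (Y₁ : ZMod q) (X₂ : ZMod q) (Y₂ : ZMod q) (X₃ : ZMod q) (Y₃ : ZMod q)
    && xDoubleFree V q (X₃ : ZMod q)

/-- Boolean: `(X₃, Y₃) ≡ (X₁, Y₁) + (X₂, Y₂)` mod `q` (chord) and `shiftFree` for `(X₃, Y₃)` and the
shift `(x_T, y_T)`. [cite: CremonaAlgorithms1997, §3.5] -/
def sumShiftFree (V : WeierstrassCurve ℤ) (q : ℕ) [NeZero q] (X₁ Y₁ X₂ Y₂ X₃ Y₃ xT yT A B : ℤ) :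
    Bool :=
  zmodChord V q (X₁ : ZMod q) (Y₁ : ZMod q) (X₂ : ZMod q) (Y₂ : ZMod q) (X₃ : ZMod q) (Y₃ : ZMod q)
    && shiftFree V q X₃ Y₃ xT yT A B

open scoped Classical in
/-- An integral point with `xDoubleFree` at a good prime is not in `2E(ℚ)`.
[cite: SilvermanAEC2009, Prop. VII.3.1(b)] -/
theorem not_mem_twoCoset_zero_of_ptFree (q : ℕ) [Fact q.Prime] (hq : ¬ (q : ℤ) ∣ V.Δ) {X Y : ℤ}
    (hX : Y ^ 2 + V.a₁ * X * Y + V.a₃ * Y = X ^ 3 + V.a₂ * X ^ 2 + V.a₄ * X + V.a₆)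
    (hw : xDoubleFree V q (X : ZMod q) = true) :
    (Affine.Point.some (X : ℚ) (Y : ℚ) (nonsingular_rat_of_eq V (Δ_ne_zero_of_not_dvd V hq) hX) :
        (V.map (Int.castRingHom ℚ)).toAffine.Point) ∉
      twoCoset (V.map (Int.castRingHom ℚ)).toAffine.Point 0 := by
  have e : V.toAffine.Equation X Y := (Affine.equation_iff X Y).mpr hX
  apply not_mem_twoCoset_of_map_not_mem (reduceMod V q hq)
  rw [reduceMod_some V q hq e]
  exact not_mem_twoCoset_of_xDoubleFree V q hw _

open scoped Classical in
/-- Soundness of `shiftFree`: `R + T ∉ 2E(ℚ)` for the integral points `R = (X, Y)`,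
`T = (x_T, y_T)`.
[cite: SilvermanAEC2009, Prop. VII.3.1(b)] -/
theorem not_mem_twoCoset_zero_of_shiftFree (q : ℕ) [Fact q.Prime] (hq : ¬ (q : ℤ) ∣ V.Δ)
    {X Y xT yT A B : ℤ}
    (hX : Y ^ 2 + V.a₁ * X * Y + V.a₃ * Y = X ^ 3 + V.a₂ * X ^ 2 + V.a₄ * X + V.a₆)
    (hT : yT ^ 2 + V.a₁ * xT * yT + V.a₃ * yT = xT ^ 3 + V.a₂ * xT ^ 2 + V.a₄ * xT + V.a₆)
    (hw : shiftFree V q X Y xT yT A B = true) :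
    (Affine.Point.some (X : ℚ) (Y : ℚ) (nonsingular_rat_of_eq V (Δ_ne_zero_of_not_dvd V hq) hX) +
        Affine.Point.some (xT : ℚ) (yT : ℚ)
          (nonsingular_rat_of_eq V (Δ_ne_zero_of_not_dvd V hq) hT) :
        (V.map (Int.castRingHom ℚ)).toAffine.Point) ∉
      twoCoset (V.map (Int.castRingHom ℚ)).toAffine.Point 0 := by
  simp only [shiftFree, Bool.and_eq_true] at hw
  obtain ⟨hc, hfree⟩ := hw
  have e : V.toAffine.Equation X Y := (Affine.equation_iff X Y).mpr hX
  have eT : V.toAffine.Equation xT yT := (Affine.equation_iff xT yT).mpr hT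
  apply not_mem_twoCoset_of_map_not_mem (reduceMod V q hq)
  obtain ⟨h₃, e₃⟩ := exists_some_add_some_of_zmodChord V q
    (nonsingular_zmod_of_equation V q hq e) (nonsingular_zmod_of_equation V q hq eT) hc
  rw [map_add, reduceMod_some V q hq e, reduceMod_some V q hq eT, e₃]
  exact not_mem_twoCoset_of_xDoubleFree V q hfree h₃

open scoped Classical in
/-- Soundness of `sumFree`: `P₁ + P₂ ∉ 2E(ℚ)` for integral points `Pᵢ = (Xᵢ, Yᵢ)`.
[cite: SilvermanAEC2009, Prop. VII.3.1(b)] -/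
theorem not_mem_twoCoset_zero_of_sumFree (q : ℕ) [Fact q.Prime] (hq : ¬ (q : ℤ) ∣ V.Δ)
    {X₁ Y₁ X₂ Y₂ X₃ Y₃ : ℤ}
    (h₁ : Y₁ ^ 2 + V.a₁ * X₁ * Y₁ + V.a₃ * Y₁ = X₁ ^ 3 + V.a₂ * X₁ ^ 2 + V.a₄ * X₁ + V.a₆)
    (h₂ : Y₂ ^ 2 + V.a₁ * X₂ * Y₂ + V.a₃ * Y₂ = X₂ ^ 3 + V.a₂ * X₂ ^ 2 + V.a₄ * X₂ + V.a₆)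
    (hw : sumFree V q X₁ Y₁ X₂ Y₂ X₃ Y₃ = true) :
    (Affine.Point.some (X₁ : ℚ) (Y₁ : ℚ) (nonsingular_rat_of_eq V (Δ_ne_zero_of_not_dvd V hq) h₁) +
        Affine.Point.some (X₂ : ℚ) (Y₂ : ℚ)
          (nonsingular_rat_of_eq V (Δ_ne_zero_of_not_dvd V hq) h₂) :
        (V.map (Int.castRingHom ℚ)).toAffine.Point) ∉
      twoCoset (V.map (Int.castRingHom ℚ)).toAffine.Point 0 := by
  simp only [sumFree, Bool.and_eq_true] at hw
  obtain ⟨hc, hfree⟩ := hw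
  have e₁ : V.toAffine.Equation X₁ Y₁ := (Affine.equation_iff X₁ Y₁).mpr h₁
  have e₂ : V.toAffine.Equation X₂ Y₂ := (Affine.equation_iff X₂ Y₂).mpr h₂
  apply not_mem_twoCoset_of_map_not_mem (reduceMod V q hq)
  obtain ⟨h₃, e₃⟩ := exists_some_add_some_of_zmodChord V q
    (nonsingular_zmod_of_equation V q hq e₁) (nonsingular_zmod_of_equation V q hq e₂) hc
  rw [map_add, reduceMod_some V q hq e₁, reduceMod_some V q hq e₂, e₃]
  exact not_mem_twoCoset_of_xDoubleFree V q hfree h₃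

open scoped Classical in
/-- Soundness of `sumShiftFree`: `P₁ + P₂ + T ∉ 2E(ℚ)` for integral `P₁, P₂, T`.
[cite: SilvermanAEC2009, Prop. VII.3.1(b)] -/
theorem not_mem_twoCoset_zero_of_sumShiftFree (q : ℕ) [Fact q.Prime] (hq : ¬ (q : ℤ) ∣ V.Δ)
    {X₁ Y₁ X₂ Y₂ X₃ Y₃ xT yT A B : ℤ}
    (h₁ : Y₁ ^ 2 + V.a₁ * X₁ * Y₁ + V.a₃ * Y₁ = X₁ ^ 3 + V.a₂ * X₁ ^ 2 + V.a₄ * X₁ + V.a₆)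
    (h₂ : Y₂ ^ 2 + V.a₁ * X₂ * Y₂ + V.a₃ * Y₂ = X₂ ^ 3 + V.a₂ * X₂ ^ 2 + V.a₄ * X₂ + V.a₆)
    (hT : yT ^ 2 + V.a₁ * xT * yT + V.a₃ * yT = xT ^ 3 + V.a₂ * xT ^ 2 + V.a₄ * xT + V.a₆)
    (hw : sumShiftFree V q X₁ Y₁ X₂ Y₂ X₃ Y₃ xT yT A B = true) :
    (Affine.Point.some (X₁ : ℚ) (Y₁ : ℚ) (nonsingular_rat_of_eq V (Δ_ne_zero_of_not_dvd V hq) h₁) +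
        Affine.Point.some (X₂ : ℚ) (Y₂ : ℚ)
          (nonsingular_rat_of_eq V (Δ_ne_zero_of_not_dvd V hq) h₂) +
        Affine.Point.some (xT : ℚ) (yT : ℚ)
          (nonsingular_rat_of_eq V (Δ_ne_zero_of_not_dvd V hq) hT) :
        (V.map (Int.castRingHom ℚ)).toAffine.Point) ∉
      twoCoset (V.map (Int.castRingHom ℚ)).toAffine.Point 0 := by
  simp only [sumShiftFree, shiftFree, Bool.and_eq_true] at hw
  obtain ⟨hc, hc', hfree⟩ := hw
  have e₁ : V.toAffine.Equation X₁ Y₁ := (Affine.equation_iff X₁ Y₁).mpr h₁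
  have e₂ : V.toAffine.Equation X₂ Y₂ := (Affine.equation_iff X₂ Y₂).mpr h₂
  have eT : V.toAffine.Equation xT yT := (Affine.equation_iff xT yT).mpr hT
  apply not_mem_twoCoset_of_map_not_mem (reduceMod V q hq)
  obtain ⟨h₃, e₃⟩ := exists_some_add_some_of_zmodChord V q
    (nonsingular_zmod_of_equation V q hq e₁) (nonsingular_zmod_of_equation V q hq e₂) hc
  obtain ⟨h₄, e₄⟩ := exists_some_add_some_of_zmodChord V q h₃
    (nonsingular_zmod_of_equation V q hq eT) hc'
  rw [map_add, map_add, reduceMod_some V q hq e₁, reduceMod_some V q hq e₂, e₃,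
    reduceMod_some V q hq eT, e₄]
  exact not_mem_twoCoset_of_xDoubleFree V q hfree h₄

end Shift

end Summit.BirchSwinnertonDyer.BirchSwinnertonDyer.Rank2Observatory
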